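/-
Copyright (c) 2026 the pub-hodgecm-mathlib formalisation cell (harness21).  Prover seat hodgecm-mathlib-K2E3-p34 (g2), Track B «K2-LIT», engine E3, unit U4 «Keys»; PART
«U4Keys» socket :182 (U4f-χ₁-ram-one-pos), programme A_pos^{<} (cond(χ₁|_{F×}) < cond χ₁), brick (ii)^{<}-CM «THE DEEP BIG CELL FOR THE TWO-DEPTH GROUP `J_e` ON
`U(Φ₃)(L⁺_v)`» (CM dress of ★ `K2E3LowerUnipotentDeepCellTwoDepth`, the `J_e`-twin of ★ (c1) `K2E3LowerUnipotentBigCellCM`); dealer K2E3-plan (g5), K2 bus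
2026-09-04T22:22:37Z.  KERNEL module: THEOREMS ONLY (no definition, no named fact, no `sorry`, no instance, no notation).
-/
import Summits.HodgeConjecture.HodgeConjecture.Theorems.K2E3LowerUnipotentBigCellCM            -- ★ (c1) (this seat): `map_weylConj_mem_map`, `exists_coe_map_weylConj_eq_lower`; brings the (G3) frame ★ Z2A-3c, `symm_mem_P_of_mem_borelU`, `map_weyl_eq_weylLongU`
import Summits.HodgeConjecture.HodgeConjecture.Theorems.K2E3LowerUnipotentDeepCellTwoDepth    -- ★ (ii)^{<} MODEL (this seat): `exists_borel_mul_weylLongU_mul_mem_of_le_v` ∕ `_of_v_div_le`; brings ★ D174's letters `e Jg hJg`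
import HarnessLib

/-!
# K2 ∕ E3 «EllipticInputs», unit U4 «Keys» — socket :182 (positive depth), programme A_pos^{<}, brick (ii)^{<}-CM: THE DEEP BIG CELL FOR THE TWO-DEPTH GROUP, CM DRESS
# «`|z| ≥ |ϖ|^{-2r}`, `|z| ≥ |ϖ|^{-s}` ⟹ `w₀ n w₀ = h · w₀ · b′` with `h ∈ P`, `b′ ∈ J_e`» on `U(Φ₃)(L⁺_v)`, `v` non-split, where `ū(x, z) = eA(w₀ n w₀)`
# [Casselman1995 Prop. 1.3.1; BruhatTits1972 (4.4.4), (6.4.9); Roche1998 §3–§4; Rogawski1990 §1.10]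

Cell hodgecm-mathlib, Track B «K2-LIT», engine E3, crux item H413 = `stmt-HodgeConjecture-24833` (route `HCCMUnconditional`); line `K2_E3_EllipticInputs`, PART «U4Keys»
socket :182 `sig_K2E3KeysThmTwoContractingRamifiedCharOnePosDepth` (Branch A at POSITIVE depth; regime A_pos^{<} of K2E3-p37 (g0)'s memo §9 and of this seat's memo
`K2/K2E3-p34/g2/CENSUS-Apos-lt-shells.md`).  `--supports stmt-HodgeConjecture-24833 --as helper`; THEOREMS ONLY; NOT THE PAYER.

THE POINT.  The cell-family engine ★ `K2E3BranchAContradictionCells` (p861573) will run on A_pos^{<} at `B := J_e`, the two-depth (concave-exponent) level group of ★ D174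
`K2E3IwahoriTwoDepthFactorisation` (model letters `e`, `Jg`, `hJg : ∀ k, k ∈ Jg ↔ ∀ i j, |k i j| ≤ |ϖ| ^ e i j`), pulled back along the (G3) equivalence `eA` as
`Je = Jg.comap eA` (letter `hJe`).  Its covering letter `hcells` needs, for `n ∈ N` with `ū(x, z) := eA(w₀ n w₀)` on the DEEP big cell `|z| ≥ |ϖ|^{-2·e 0 1}`, `|z| ≥ |ϖ|^{-e 0 2}`
(sharp form: `|x∕z| ≤ |ϖ|^{e 0 1}`, `|z| ≥ |ϖ|^{-e 0 2}`), the representative `r = w₀`: `w₀ n w₀ = h · w₀ · b′`, `h ∈ P`, `b′ ∈ Je`.  This is ★ `K2E3LowerUnipotentDeepCellTwoDepth`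
(MODEL, one-place `U(σ_w, Φ₃)(L_w)`) read through `eA` exactly as ★ (c1) reads ★ p861613 (`eA⁻¹ p ∈ P` ★ `symm_mem_P_of_mem_borelU`, `eA⁻¹ u ∈ Je` by `Subgroup.mem_comap`,
`eA w₀ = w` ★ `map_weyl_eq_weylLongU`); the coordinates `(x, z)` are ★ (c1) `exists_coe_map_weylConj_eq_lower` BY NAME.  The witness `hwit(w₀)` on this cell is the depth-zero
torus witness transported along `b′` (twin of ★ `K2E3BranchATorusWitnessLevelN` with `Jn ↦ Je`, not in this file); the UPPER shells `1 ≤ |z| < |ϖ|^{-2r}` and the LOWER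
shells `|z| < 1` are other members of the two-depth cell family (memo §2–§4).
* §1 `symm_mem_comap_of_mem` (`eA⁻¹ u ∈ Jg.comap eA` for `u ∈ Jg`).
* §2 **`exists_eq_borel_mul_weyl_mul_mem_of_le_v`** — DEEP cell in the engine's letters: `(|ϖ|^{2·e 0 1})⁻¹ ≤ |(eA(w₀ n w₀))₂₀|`, `(|ϖ|^{e 0 2})⁻¹ ≤ |(eA(w₀ n w₀))₂₀|` ⟹
  `∃ h ∈ t.P, ∃ b′ ∈ Je, w₀ n w₀ = h * w₀ * b′`; **`exists_eq_borel_mul_weyl_mul_mem_of_coe_eq`** — SHARP cell on the §1-coordinates of ★ (c1): `eA(w₀ n w₀) = ū(x, z)`,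
  `|x∕z| ≤ |ϖ|^{e 0 1}`, `(|ϖ|^{e 0 2})⁻¹ ≤ |z|` ⟹ same conclusion (the shape in which an assembly splits `N` on `Valued.v z`, `Valued.v (x∕z)`).
HONEST LABEL: HC_CM is proved only modulo the 7 printed citations (2 remaining named inputs: hLiu418 = stmt-HodgeConjecture-24832, h413 = stmt-HodgeConjecture-24833) until
rung 0 closes; count-neutral — this file does NOT pay the leaf; :182 stays OPEN.

## References
* [Casselman1995] W. Casselman, *Introduction to the theory of admissible representations of p-adic reductive groups* (1995), Prop. 1.3.1 (Bruhat decomposition), Prop. 1.4.4.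
* [BruhatTits1972] F. Bruhat, J. Tits, Publ. Math. IHÉS 41 (1972), (4.4.3)–(4.4.4), (6.4.9) (concave functions, the groups `P_f`).
* [Roche1998] A. Roche, Ann. Sci. ÉNS (4) 31 (1998), §3–§4 (the groups `J_χ` and the support of `(J, θ)`-spherical vectors).
* [Rogawski1990] J. D. Rogawski, *Automorphic Representations of Unitary Groups in Three Variables*, Ann. of Math. Stud. 123 (1990), §1.10 p. 9.
* [PlatonovRapinchuk1994] V. Platonov, A. Rapinchuk, *Algebraic Groups and Number Theory* (1994), §5.1 (the one-place model at a non-split place).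
-/

set_option autoImplicit false
-- the mandated namespace has the single-problem summit's repeated segment (`HodgeConjecture.HodgeConjecture`)
set_option linter.dupNamespace false

noncomputable section

open NumberField IsDedekindDomain
open scoped Matrix MatrixGroups WithZero Valued
open Literature.NumberTheory Literature.NumberTheory.Automorphic Literature.NumberTheory.Automorphic.UnitaryGroup
open Literature.NumberTheory.Rogawski1990

namespace Summit.HodgeConjecture.HodgeConjecture.Cruxes.H413.K2E3LowerUnipotentDeepCellCM

open Summit.HodgeConjecture.HodgeConjecture.Cruxes.H413
open Summit.HodgeConjecture.HodgeConjecture.Cruxes.H413.K2E3DepthZeroIwahoriCharacterCM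
open Summit.HodgeConjecture.HodgeConjecture.Cruxes.H413.K2E3BranchALettersCM

variable (L : Type) [Field L] [NumberField L] [IsCMField L] (v : HeightOneSpectrum (𝓞 ↥(maximalRealSubfield L)))
  (w : PlacesOver L v) (hw : IsCMField.complexConj L • w.1 = w.1)
  (eA : Gqs L v ≃ₜ* ↥(unitaryGroupOfForm (galAdicCompletionMap (L := L) (IsCMField.complexConj L) hw) ((StdForm.antidiagonal 3).over (w.1.adicCompletion L))))
  (heA : ∀ g : Gqs L v,
    ((eA g : ↥(unitaryGroupOfForm (galAdicCompletionMap (L := L) (IsCMField.complexConj L) hw) ((StdForm.antidiagonal 3).over (w.1.adicCompletion L)))) :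
        GL (Fin 3) (w.1.adicCompletion L)) =
      ((localNonsplitEquiv (IsCMField.complexConj L) (qsForm L) (IsCMField.complexConj_ne_one L) w hw g :
        ↥(unitaryGroupOfForm (galAdicCompletionMap (L := L) (IsCMField.complexConj L) hw) (placeForm (qsForm L) w.1))) : GL (Fin 3) (w.1.adicCompletion L)))
  {ϖ : w.1.adicCompletion L} (hϖ : Valued.v ϖ = WithZero.exp (-1 : ℤ))
  (e : Fin 3 → Fin 3 → ℕ)
  (Jg : Subgroup ↥(unitaryGroupOfForm (galAdicCompletionMap (L := L) (IsCMField.complexConj L) hw) ((StdForm.antidiagonal 3).over (w.1.adicCompletion L))))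
  (hJg : ∀ k : ↥(unitaryGroupOfForm (galAdicCompletionMap (L := L) (IsCMField.complexConj L) hw) ((StdForm.antidiagonal 3).over (w.1.adicCompletion L))),
    k ∈ Jg ↔ ∀ i j, Valued.v (((k : GL (Fin 3) (w.1.adicCompletion L)) : Matrix (Fin 3) (Fin 3) (w.1.adicCompletion L)) i j) ≤ Valued.v ϖ ^ e i j)
  (Je : Subgroup (Gqs L v)) (hJe : Je = Jg.comap eA.toMulEquiv.toMonoidHom)
  (t : ParabolicTriple (Gqs L v)) (ht : t = cmBorelTriple L 3 v)
  (w₀ : Gqs L v) (hw₀ : Units.val (w₀.val : GL (Fin 3) (LocalRing L v)) = cmLocalForm L 3 v)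

/-! ## §1 `eA⁻¹` of an element of the model group lies in `Je = Jg.comap eA` -/

include hJe in
/-- `eA.symm u ∈ Je` for `u ∈ Jg` (`Je = Jg.comap eA`, `eA (eA.symm u) = u`). [cite: PlatonovRapinchuk1994, §5.1] -/
theorem symm_mem_comap_of_mem
    {u : ↥(unitaryGroupOfForm (galAdicCompletionMap (L := L) (IsCMField.complexConj L) hw) ((StdForm.antidiagonal 3).over (w.1.adicCompletion L)))} (hu : u ∈ Jg) :
    eA.symm u ∈ Je := by
  subst hJe
  rw [← eA.apply_symm_apply u] at hu
  exact hu

/-! ## §2 The deep big cell: `w₀ n w₀ ∈ P · w₀ · Je` -/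

include hw heA hϖ hJg hJe ht hw₀ in
/-- **THE DEEP BIG CELL FOR THE TWO-DEPTH GROUP (CM): `|(eA(w₀ n w₀))₂₀| ≥ |ϖ|^{-2·e 0 1}` and `≥ |ϖ|^{-e 0 2}` ⟹ `w₀ n w₀ = h · w₀ · b′` with `h ∈ P`, `b′ ∈ Je`** (`e i i = 0`,
anti-transpose symmetry of `e`).  ★ `K2E3LowerUnipotentDeepCellTwoDepth.exists_borel_mul_weylLongU_mul_mem_of_le_v` on the one-place model `U(σ_w, Φ₃)(L_w)` (`ū(x,z) = p·w·u(x∕z,1∕z)`,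
`u ∈ Jg` on the deep cell) pulled back along `eA` (`eA⁻¹ p ∈ P` ★ `symm_mem_P_of_mem_borelU`, `eA⁻¹ u ∈ Je` §1, `eA w₀ = w`).  This is the `hcells` disjunct of ★ p861573 at the
representative `r := w₀` for the two-depth cell family. [cite: Casselman1995, Prop. 1.3.1] [cite: BruhatTits1972, (4.4.4), (6.4.9)] [cite: Roche1998, §3–§4] [cite: Rogawski1990, §1.10 p. 9] -/
theorem exists_eq_borel_mul_weyl_mul_mem_of_le_v (he0 : ∀ i, e i i = 0) (hsym : ∀ i j, e (Fin.rev j) (Fin.rev i) = e i j) {n : Gqs L v} (hn : n ∈ t.N)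
    (hz : (Valued.v ϖ ^ (2 * e 0 1))⁻¹ ≤ Valued.v ((((eA (w₀ * n * w₀) :
        ↥(unitaryGroupOfForm (galAdicCompletionMap (L := L) (IsCMField.complexConj L) hw) ((StdForm.antidiagonal 3).over (w.1.adicCompletion L)))) :
          GL (Fin 3) (w.1.adicCompletion L)) : Matrix (Fin 3) (Fin 3) (w.1.adicCompletion L)) 2 0))
    (hz' : (Valued.v ϖ ^ e 0 2)⁻¹ ≤ Valued.v ((((eA (w₀ * n * w₀) :
        ↥(unitaryGroupOfForm (galAdicCompletionMap (L := L) (IsCMField.complexConj L) hw) ((StdForm.antidiagonal 3).over (w.1.adicCompletion L)))) :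
          GL (Fin 3) (w.1.adicCompletion L)) : Matrix (Fin 3) (Fin 3) (w.1.adicCompletion L)) 2 0)) :
    ∃ h ∈ t.P, ∃ b' ∈ Je, w₀ * n * w₀ = h * w₀ * b' := by
  have hσσ : ∀ x, (galAdicCompletionMap (L := L) (IsCMField.complexConj L) hw) ((galAdicCompletionMap (L := L) (IsCMField.complexConj L) hw) x) = x :=
    galAdicCompletionMap_galAdicCompletionMap_of_smul_eq (IsCMField.complexConj L) w (IsCMField.complexConj_ne_one L) hw
  have hvσ : ∀ x, Valued.v (galAdicCompletionMap (L := L) (IsCMField.complexConj L) hw x) = Valued.v x :=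
    fun x => valued_galAdicCompletionMap (L := L) (IsCMField.complexConj L) hw x
  have hwL := map_weyl_eq_weylLongU L v w hw eA heA w₀ hw₀
  obtain ⟨p, hp, u, hu, heq⟩ := K2E3LowerUnipotentDeepCellTwoDepth.exists_borel_mul_weylLongU_mul_mem_of_le_v
    (galAdicCompletionMap (L := L) (IsCMField.complexConj L) hw) (rfl : (StdForm.antidiagonal 3).over (w.1.adicCompletion L) = _) hσσ hvσ hϖ e Jg hJg he0 hsym
    (K2E3LowerUnipotentBigCellCM.map_weylConj_mem_map L v w hw eA heA t ht w₀ hw₀ hn) hz hz'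
  refine ⟨eA.symm p, symm_mem_P_of_mem_borelU L v w hw eA heA t ht hp, eA.symm u, symm_mem_comap_of_mem L v w hw eA Jg Je hJe hu, ?_⟩
  apply eA.injective
  rw [heq, map_mul, map_mul, ContinuousMulEquiv.apply_symm_apply, ContinuousMulEquiv.apply_symm_apply, hwL]

include hw heA hϖ hJg hJe ht hw₀ in
/-- **SHARP CELL, coordinate form**: if `eA(w₀ n w₀) = !![1, 0, 0; -σ x, 1, 0; z, x, 1]` (★ (c1) `exists_coe_map_weylConj_eq_lower`), `|x∕z| ≤ |ϖ|^{e 0 1}` and `|z| ≥ |ϖ|^{-e 0 2}`,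
then `w₀ n w₀ = h · w₀ · b′` with `h ∈ P`, `b′ ∈ Je` (★ `exists_borel_mul_weylLongU_mul_mem_of_v_div_le` through `eA`) — the shape in which an assembly calls the big cell
after splitting `N` on `Valued.v z` and `Valued.v (x ∕ z)`. [cite: Casselman1995, Prop. 1.3.1] [cite: BruhatTits1972, (4.4.4), (6.4.9)] [cite: Roche1998, §3–§4] -/
theorem exists_eq_borel_mul_weyl_mul_mem_of_coe_eq (he0 : ∀ i, e i i = 0) (hsym : ∀ i j, e (Fin.rev j) (Fin.rev i) = e i j) {n : Gqs L v} (hn : n ∈ t.N)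
    {x z : w.1.adicCompletion L}
    (hxz : (((eA (w₀ * n * w₀) :
        ↥(unitaryGroupOfForm (galAdicCompletionMap (L := L) (IsCMField.complexConj L) hw) ((StdForm.antidiagonal 3).over (w.1.adicCompletion L)))) :
          GL (Fin 3) (w.1.adicCompletion L)) : Matrix (Fin 3) (Fin 3) (w.1.adicCompletion L)) =
        !![1, 0, 0; -(galAdicCompletionMap (L := L) (IsCMField.complexConj L) hw) x, 1, 0; z, x, 1])
    (hx : Valued.v (x / z) ≤ Valued.v ϖ ^ e 0 1) (hz' : (Valued.v ϖ ^ e 0 2)⁻¹ ≤ Valued.v z) :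
    ∃ h ∈ t.P, ∃ b' ∈ Je, w₀ * n * w₀ = h * w₀ * b' := by
  have hσσ : ∀ x, (galAdicCompletionMap (L := L) (IsCMField.complexConj L) hw) ((galAdicCompletionMap (L := L) (IsCMField.complexConj L) hw) x) = x :=
    galAdicCompletionMap_galAdicCompletionMap_of_smul_eq (IsCMField.complexConj L) w (IsCMField.complexConj_ne_one L) hw
  have hvσ : ∀ x, Valued.v (galAdicCompletionMap (L := L) (IsCMField.complexConj L) hw x) = Valued.v x :=
    fun x => valued_galAdicCompletionMap (L := L) (IsCMField.complexConj L) hw x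
  have hwL := map_weyl_eq_weylLongU L v w hw eA heA w₀ hw₀
  -- the relation `z + σz + xσx = 0` from the lower-unipotent shape of `eA(w₀ n w₀)`
  obtain ⟨x', z', hxz', hrel'⟩ := K2E3LowerUnipotentBigCellCM.exists_coe_map_weylConj_eq_lower L v w hw eA heA t ht w₀ hw₀ hn
  have hx' : x' = x := by
    have h21 := congr_fun (congr_fun hxz' 2) 1
    rw [hxz] at h21
    simpa using h21.symm
  have hz'' : z' = z := by
    have h20 := congr_fun (congr_fun hxz' 2) 0
    rw [hxz] at h20
    simpa using h20.symm
  subst hx' hz''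
  obtain ⟨p, hp, u, hu, heq⟩ := K2E3LowerUnipotentDeepCellTwoDepth.exists_borel_mul_weylLongU_mul_mem_of_v_div_le
    (galAdicCompletionMap (L := L) (IsCMField.complexConj L) hw) (rfl : (StdForm.antidiagonal 3).over (w.1.adicCompletion L) = _) hσσ hvσ hϖ e Jg hJg he0 hsym
    hxz hrel' hx hz'
  refine ⟨eA.symm p, symm_mem_P_of_mem_borelU L v w hw eA heA t ht hp, eA.symm u, symm_mem_comap_of_mem L v w hw eA Jg Je hJe hu, ?_⟩
  apply eA.injective
  rw [heq, map_mul, map_mul, ContinuousMulEquiv.apply_symm_apply, ContinuousMulEquiv.apply_symm_apply, hwL]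

end Summit.HodgeConjecture.HodgeConjecture.Cruxes.H413.K2E3LowerUnipotentDeepCellCM

end
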